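import Literature.Barriers.AtomisticToContinuum.DisorderedHarmonicChainLowerMain
import Literature.Barriers.AtomisticToContinuum.DisorderedHarmonicChainPointwiseU
import Literature.Barriers.AtomisticToContinuum.DisorderedHarmonicChainResonantSet
import Literature.Barriers.AtomisticToContinuum.DisorderedHarmonicChainPositivity
import Mathlib.MeasureTheory.Integral.MeanInequalities
import HarnessLib

/-!
# Ajanki–Huveneers 2011, Prop. 5.1: the lower bound (5.2), and the discharge of Prop. 5.1

Last file of the potential theory of the phase chain `X^x_n` (O. Ajanki, F. Huveneers,
CMP **301** (2011) 841–883, arXiv:1003.1076, §5, Prop. 5.1):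
"`𝔼(e^{w∑_{k=1}^n h(X^x_{k-1})B_k} u(X^x_n)) ≥ K' ∫_𝕋 u(y) dy` for `1/2 ≤ w²n ≤ 1`" (5.2). The upper
bound (5.1) is the theorem `potentialTheory_upper` (`…PotentialUpper.lean`). Here we PROVE (5.2)
and hence the named fact `AjankiHuveneers2011_potentialTheory` of `…Phases.lean`
(`AjankiHuveneers2011_potentialTheory_holds`).

Route (library-first): the lower bound (5.2) for `h ≡ 0` and continuous `1`-periodic `u ≥ 0`,
uniformly in the start, is `potential_lower_continuous` of `…LowerMain.lean` (Markov split, the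
Fejér minorisation `smoothing_lower_bound` fed by `translation_bound` and `clt_low_frequency`, the
uniform start `uniform_start_lower` and the upper bound `potentialTheory_upper`). Here:

* `potential_lower_measurable` — extension to measurable `1`-periodic `u ≥ 0` by domination of
  measures on the circle from continuous test functions (`periodic_density_lower`), together with
  the integrability of `u(X_n)` (from `potentialTheory_upper`).
* `sq_integral_le_tilt` — Cauchy–Schwarz for an exponential tilt, `(∫g)² ≤ (∫e^{S}g)(∫e^{-S}g)`.
* `AjankiHuveneers2011_potentialTheory_holds` — the tilt `e^{w∑h(X_{k-1})B_k}` is put back by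
  Cauchy–Schwarz against the upper bound (5.1) with tilt `-h`; general `u ∈ L¹(𝕋; ℝ₊)` through a
  measurable periodic modification, which the law of `X_n mod 1` does not see
  (`periodic_density_bound`, `exists_measurable_periodic_modification`).
* `AjankiHuveneers2011_scaling_holds` — Theorem 1.1, assembled from the cluster.

[cite: AjankiHuveneers2011, Prop. 5.1 eqs. (5.1)-(5.2) and its proof ("third observation")]
-/

noncomputable section

open Real MeasureTheory Set Filter Function Finset
open scoped ENNReal NNReal

namespace Literature.Barriers.AtomisticToContinuum.HeatConduction

variable {τ : ℝ → ℝ} {bm bp : ℝ}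

/-! ### Transfer to measurable test functions -/

set_option maxHeartbeats 800000 in
/-- **Prop. 5.1 (5.2) for `h ≡ 0` and measurable `u`**: for `0 < w ≤ w₀`, every measurable
`1`-periodic `u ≥ 0` integrable on `[0,1)`, every `x` and every `n` with `1/2 ≤ w²n ≤ 1`,
`u(X^x_n)` is integrable and `K' ∫_{[0,1)} u ≤ 𝔼 u(X^x_n)`. [cite: AjankiHuveneers2011, Prop. 5.1 eq. (5.2)] -/
theorem potential_lower_measurable (hτ : ReducedLawHyp τ bm bp) (ρB : Measure ℝ) [IsProbabilityMeasure ρB]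
    (hρ : ρB = volume.withDensity fun s => ENNReal.ofReal (τ s)) :
    ∃ K' w₀ : ℝ, 0 < K' ∧ 0 < w₀ ∧ ∀ w ∈ Set.Ioc 0 w₀,
      ∀ u : ℝ → ℝ, Measurable u → Function.Periodic u 1 → (∀ y, 0 ≤ u y) → IntegrableOn u (Set.Ico 0 1) →
        ∀ x : ℝ, ∀ n : ℕ, 1 / 2 ≤ w ^ 2 * n → w ^ 2 * n ≤ 1 →
          Integrable (fun B => u (ahPhase w x (finExt B) n)) (Measure.pi fun _ : Fin n => ρB) ∧
          K' * ∫ y in Set.Ico (0:ℝ) 1, u y ≤ ∫ B, u (ahPhase w x (finExt B) n) ∂(Measure.pi fun _ : Fin n => ρB) := by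
  obtain ⟨K', wL, hK', hwL, hlow⟩ := potential_lower_continuous hτ ρB hρ
  have hκ : (0 : ℝ) < 1 / 8 := by norm_num
  obtain ⟨KP, wP, hKP, hwP, hup⟩ :=
    potentialTheory_upper τ bm bp hτ ρB hρ (1 / 8) hκ (fun _ => 0) (fun _ => rfl) contDiff_const
  refine ⟨K', min (min wL wP) (1 / 2), hK', by positivity, ?_⟩
  intro w hw u hum huper hu0 huint x n hn1 hn2
  obtain ⟨hw0, hwle⟩ := hw
  have hwL' : w ∈ Set.Ioc 0 wL := ⟨hw0, hwle.trans ((min_le_left _ _).trans (min_le_left _ _))⟩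
  have hwP' : w ∈ Set.Ioc 0 wP := ⟨hw0, hwle.trans ((min_le_left _ _).trans (min_le_right _ _))⟩
  have hw12 : w ≤ 1 / 2 := hwle.trans (min_le_right _ _)
  have hκn : 1 / 8 ≤ w * n := by
    have h1 : w * (w * n) ≥ 1 / 2 := by rw [← mul_assoc, ← sq]; exact hn1
    have h2 : (0:ℝ) ≤ n := Nat.cast_nonneg _
    nlinarith [mul_nonneg hw0.le h2]
  set μ := (Measure.pi fun _ : Fin n => ρB) with hμ
  set X : (Fin n → ℝ) → ℝ := fun B => ahPhase w x (finExt B) n with hXdef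
  have hXm : Measurable X := measurable_ahPhase_pi w x n
  -- integrability from the upper bound
  have hint : Integrable (fun B => u (X B)) μ := by
    have := (hup w hwP' u huper hu0 huint x n hκn hn2).1
    simpa using this
  refine ⟨hint, ?_⟩
  -- the transfer
  have hcont : ∀ φ : ℝ → ℝ, Continuous φ → Function.Periodic φ 1 → (∀ y, 0 ≤ φ y) →
      Integrable (fun ω => φ (X ω)) μ ∧ K' * ∫ y in Set.Ico (0:ℝ) 1, φ y ≤ ∫ ω, φ (X ω) ∂μ := by
    intro φ hφc hφper hφ0
    obtain ⟨M, -, hM⟩ := exists_bound_of_periodic hφc hφper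
    refine ⟨Integrable.mono' (integrable_const M) ((hφc.measurable.comp hXm).aestronglyMeasurable)
      (ae_of_all _ fun B => by rw [Real.norm_eq_abs]; exact hM _), ?_⟩
    exact hlow w hwL' φ hφc hφper hφ0 x n hn1 hn2
  have hper' : Function.Periodic (fun y => ENNReal.ofReal (u y)) 1 := fun y => by simp only [huper y]
  have h := periodic_density_lower μ hXm hK' hcont (fun y => ENNReal.ofReal (u y))
    (ENNReal.measurable_ofReal.comp hum) hper'
  rw [← ofReal_integral_eq_lintegral_ofReal huint (ae_of_all _ fun y => hu0 y),
    ← ofReal_integral_eq_lintegral_ofReal hint (ae_of_all _ fun B => hu0 _),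
    ← ENNReal.ofReal_mul hK'.le] at h
  exact (ENNReal.ofReal_le_ofReal_iff (integral_nonneg fun B => hu0 _)).mp h

/-! ### The tilt by Cauchy–Schwarz -/

/-- **Cauchy–Schwarz for an exponential tilt**: for `g ≥ 0`,
`(∫ g)² ≤ (∫ e^{S} g)(∫ e^{-S} g)`. [folklore] -/
theorem sq_integral_le_tilt {Ω : Type*} [MeasurableSpace Ω] (μ : Measure Ω) {S g : Ω → ℝ}
    (hS : Measurable S) (hg : Measurable g) (hg0 : ∀ ω, 0 ≤ g ω)
    (hp : Integrable (fun ω => Real.exp (S ω) * g ω) μ) (hm : Integrable (fun ω => Real.exp (-S ω) * g ω) μ) :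
    (∫ ω, g ω ∂μ) ^ 2 ≤ (∫ ω, Real.exp (S ω) * g ω ∂μ) * (∫ ω, Real.exp (-S ω) * g ω ∂μ) := by
  set f₁ : Ω → ℝ := fun ω => Real.exp (S ω / 2) * Real.sqrt (g ω) with hf₁
  set f₂ : Ω → ℝ := fun ω => Real.exp (-(S ω / 2)) * Real.sqrt (g ω) with hf₂
  have hf₁m : Measurable f₁ := (Real.measurable_exp.comp (hS.div_const 2)).mul (Real.continuous_sqrt.measurable.comp hg)
  have hf₂m : Measurable f₂ := (Real.measurable_exp.comp (hS.div_const 2).neg).mul (Real.continuous_sqrt.measurable.comp hg)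
  have hsq₁ : ∀ ω, f₁ ω ^ 2 = Real.exp (S ω) * g ω := by
    intro ω
    simp only [hf₁]
    rw [mul_pow, Real.sq_sqrt (hg0 ω), sq, ← Real.exp_add]
    ring_nf
  have hsq₂ : ∀ ω, f₂ ω ^ 2 = Real.exp (-S ω) * g ω := by
    intro ω
    simp only [hf₂]
    rw [mul_pow, Real.sq_sqrt (hg0 ω), sq, ← Real.exp_add]
    ring_nf
  have hprod : ∀ ω, f₁ ω * f₂ ω = g ω := by
    intro ω
    simp only [hf₁, hf₂]
    have h1 : Real.exp (S ω / 2) * Real.exp (-(S ω / 2)) = 1 := by rw [← Real.exp_add, add_neg_cancel, Real.exp_zero]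
    calc Real.exp (S ω / 2) * Real.sqrt (g ω) * (Real.exp (-(S ω / 2)) * Real.sqrt (g ω))
        = (Real.exp (S ω / 2) * Real.exp (-(S ω / 2))) * (Real.sqrt (g ω) * Real.sqrt (g ω)) := by ring
      _ = g ω := by rw [h1, one_mul, Real.mul_self_sqrt (hg0 ω)]
  have hL₁ : MemLp f₁ (ENNReal.ofReal 2) μ := by
    rw [show ENNReal.ofReal 2 = 2 by norm_num]
    exact (memLp_two_iff_integrable_sq hf₁m.aestronglyMeasurable).mpr (hp.congr (ae_of_all _ fun ω => (hsq₁ ω).symm))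
  have hL₂ : MemLp f₂ (ENNReal.ofReal 2) μ := by
    rw [show ENNReal.ofReal 2 = 2 by norm_num]
    exact (memLp_two_iff_integrable_sq hf₂m.aestronglyMeasurable).mpr (hm.congr (ae_of_all _ fun ω => (hsq₂ ω).symm))
  have hCS := integral_mul_le_Lp_mul_Lq_of_nonneg Real.HolderConjugate.two_two
    (ae_of_all _ fun ω => by positivity : 0 ≤ᵐ[μ] f₁) (ae_of_all _ fun ω => by positivity : 0 ≤ᵐ[μ] f₂) hL₁ hL₂
  simp only [hprod, Real.rpow_two, hsq₁, hsq₂] at hCS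
  set A := ∫ ω, Real.exp (S ω) * g ω ∂μ with hA
  set B := ∫ ω, Real.exp (-S ω) * g ω ∂μ with hB
  have hA0 : 0 ≤ A := integral_nonneg fun ω => mul_nonneg (Real.exp_pos _).le (hg0 ω)
  have hB0 : 0 ≤ B := integral_nonneg fun ω => mul_nonneg (Real.exp_pos _).le (hg0 ω)
  have hI0 : 0 ≤ ∫ ω, g ω ∂μ := integral_nonneg hg0
  have hroot : A ^ (1 / (2:ℝ)) * B ^ (1 / (2:ℝ)) = Real.sqrt (A * B) := by
    rw [Real.sqrt_eq_rpow, Real.mul_rpow hA0 hB0]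
  rw [hroot] at hCS
  calc (∫ ω, g ω ∂μ) ^ 2 ≤ Real.sqrt (A * B) ^ 2 := pow_le_pow_left₀ hI0 hCS 2
    _ = A * B := Real.sq_sqrt (mul_nonneg hA0 hB0)

end Literature.Barriers.AtomisticToContinuum.HeatConduction

namespace Literature.Barriers.AtomisticToContinuum

open HeatConduction

set_option maxHeartbeats 1600000 in
/-- **Prop. 5.1 DISCHARGED**: the two-sided potential-theory estimate
`AjankiHuveneers2011_potentialTheory` (O. Ajanki, F. Huveneers, CMP 301 (2011), Prop. 5.1,
eqs. (5.1)-(5.2)) holds. The upper bound is `potentialTheory_upper`; the lower bound is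
`potential_lower_measurable` (`h ≡ 0`) with the tilt reinstated by Cauchy–Schwarz against the
upper bound for `-h`, `(𝔼v(X_n))² ≤ 𝔼(e^{S}v(X_n))·𝔼(e^{-S}v(X_n))`, on a measurable periodic
modification `v` of `u` that the law of `X_n mod 1` does not distinguish from `u`.
[cite: AjankiHuveneers2011, Prop. 5.1 eqs. (5.1)-(5.2)] -/
theorem AjankiHuveneers2011_potentialTheory_holds : AjankiHuveneers2011_potentialTheory := by
  intro τ bm bp hτ ρB _ hρ κ hκ h hper hh
  obtain ⟨K, wK, hK, hwK, hupper⟩ := potentialTheory_upper τ bm bp hτ ρB hρ κ hκ h hper hh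
  have hκ' : (0 : ℝ) < 1 / 8 := by norm_num
  obtain ⟨Kp, wp, hKp, hwp, hup⟩ := potentialTheory_upper τ bm bp hτ ρB hρ (1 / 8) hκ' h hper hh
  have hperm : Function.Periodic (fun y => -h y) 1 := fun y => by show -h (y + 1) = -h y; rw [hper y]
  obtain ⟨Km, wm, hKm, hwm, hum⟩ :=
    potentialTheory_upper τ bm bp hτ ρB hρ (1 / 8) hκ' (fun y => -h y) hperm hh.neg
  obtain ⟨K0, w0, hK0, hw0u, hu0up⟩ :=
    potentialTheory_upper τ bm bp hτ ρB hρ (1 / 8) hκ' (fun _ => 0) (fun _ => rfl) contDiff_const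
  obtain ⟨KL, wL, hKL, hwL, hlow⟩ := potential_lower_measurable hτ ρB hρ
  set K' : ℝ := KL ^ 2 / (2 * Km) with hK'
  set ws : ℝ := min (min wK (min wp wm)) (min (min w0 wL) (1 / 2)) with hws
  refine ⟨K, K', ws, hK, by positivity, by positivity, ?_⟩
  intro w hw u huper hu0 huint x n
  obtain ⟨hw0, hwle⟩ := hw
  have hwK' : w ∈ Set.Ioc 0 wK := ⟨hw0, hwle.trans ((min_le_left _ _).trans (min_le_left _ _))⟩
  have hwp' : w ∈ Set.Ioc 0 wp := ⟨hw0, hwle.trans ((min_le_left _ _).trans ((min_le_right _ _).trans (min_le_left _ _)))⟩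
  have hwm' : w ∈ Set.Ioc 0 wm := ⟨hw0, hwle.trans ((min_le_left _ _).trans ((min_le_right _ _).trans (min_le_right _ _)))⟩
  have hw0' : w ∈ Set.Ioc 0 w0 := ⟨hw0, hwle.trans ((min_le_right _ _).trans ((min_le_left _ _).trans (min_le_left _ _)))⟩
  have hwL' : w ∈ Set.Ioc 0 wL := ⟨hw0, hwle.trans ((min_le_right _ _).trans ((min_le_left _ _).trans (min_le_right _ _)))⟩
  have hw12 : w ≤ 1 / 2 := hwle.trans ((min_le_right _ _).trans (min_le_right _ _))
  refine ⟨fun hκn hwn => hupper w hwK' u huper hu0 huint x n hκn hwn, fun hn1 hn2 => ?_⟩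
  have hn0 : (0 : ℝ) ≤ n := Nat.cast_nonneg _
  have hκn : 1 / 8 ≤ w * n := by
    have h1 : w * (w * n) ≥ 1 / 2 := by rw [← mul_assoc, ← sq]; exact hn1
    nlinarith [mul_nonneg hw0.le hn0]
  have hwsn : 1 / 2 ≤ w * Real.sqrt n := by
    have h1 : w * Real.sqrt n = Real.sqrt (w ^ 2 * n) := by
      rw [Real.sqrt_mul (sq_nonneg w), Real.sqrt_sq hw0.le]
    rw [h1]
    calc (1:ℝ) / 2 = Real.sqrt ((1 / 2) ^ 2) := by rw [Real.sqrt_sq (by norm_num)]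
      _ ≤ Real.sqrt (w ^ 2 * n) := Real.sqrt_le_sqrt (by nlinarith)
  set μ := (Measure.pi fun _ : Fin n => ρB) with hμ
  set X : (Fin n → ℝ) → ℝ := fun B => ahPhase w x (finExt B) n with hXdef
  have hXm : Measurable X := measurable_ahPhase_pi w x n
  set S : (Fin n → ℝ) → ℝ := fun B => w * ∑ k ∈ Finset.range n, h (ahPhase w x (finExt B) k) * finExt B k
    with hSdef
  have hSm : Measurable S := by
    refine measurable_const.mul (Finset.measurable_sum _ fun k _ => ?_)
    exact (hh.continuous.measurable.comp (measurable_ahPhase_pi w x k)).mul (measurable_finExt k)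
  -- integrability of the tilted observable (part of the upper bound)
  refine ⟨(hup w hwp' u huper hu0 huint x n hκn hn2).1, ?_⟩
  -- a measurable periodic modification `v` of `u`
  obtain ⟨v, hvm, hvper, hv0, hae, N, hNm, hN0, hagree⟩ := exists_measurable_periodic_modification hu0 huint
  have hvint : IntegrableOn v (Set.Ico 0 1) := huint.congr hae
  have hintv : ∫ y in Set.Ico (0:ℝ) 1, u y = ∫ y in Set.Ico (0:ℝ) 1, v y := integral_congr_ae hae
  -- `u(X) = v(X)` almost surely: the law of `X mod 1` does not charge null sets (upper bound, `h ≡ 0`)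
  obtain ⟨-, hnullT⟩ := periodic_density_bound μ (Θ := fun _ => (1:ℝ)) measurable_const (fun _ => one_pos)
    (integrable_const _) hXm (c := K0 / (w * Real.sqrt n)) (by positivity) (fun φ hφc hφper hφ0 => by
      have hφi : IntegrableOn φ (Set.Ico 0 1) := hφc.integrableOn_Icc.mono_set Set.Ico_subset_Icc_self
      have := hu0up w hw0' φ hφper hφ0 hφi x n hκn hn2
      simpa using this)
  obtain ⟨hsm, hs0⟩ := circle_null_of_null hNm hN0
  have hbad0 := hnullT _ hsm hs0
  have haeX : (fun B => u (X B)) =ᵐ[μ] fun B => v (X B) := by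
    refine (measure_eq_zero_iff_ae_notMem.mp hbad0).mono fun B hB => ?_
    show u (X B) = v (X B)
    by_contra hne
    apply hB
    simp only [Set.mem_setOf_eq]
    have hrep : ((AddCircle.equivIco 1 0 ((X B : ℝ) : UnitAddCircle) : Set.Ico (0:ℝ) (0 + 1)) : ℝ) =
        Int.fract (X B) := by
      have := AddCircle.coe_equivIco_mk_apply (p := (1:ℝ)) (X B)
      rw [div_one, mul_one] at this
      exact this
    rw [hrep]
    have hfu : u (Int.fract (X B)) = u (X B) := by
      rw [← Int.self_sub_floor, show (X B - ⌊X B⌋ : ℝ) = X B - (⌊X B⌋ : ℤ) * (1:ℝ) by ring,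
        huper.sub_int_mul_eq]
    have hfv : v (Int.fract (X B)) = v (X B) := by
      rw [← Int.self_sub_floor, show (X B - ⌊X B⌋ : ℝ) = X B - (⌊X B⌋ : ℤ) * (1:ℝ) by ring,
        hvper.sub_int_mul_eq]
    by_contra hN
    exact hne (by rw [← hfu, ← hfv, hagree _ ⟨Int.fract_nonneg _, Int.fract_lt_one _⟩ hN])
  have haeΘ : (fun B => Real.exp (S B) * u (X B)) =ᵐ[μ] fun B => Real.exp (S B) * v (X B) :=
    haeX.mono fun B hB => by
      show Real.exp (S B) * u (X B) = Real.exp (S B) * v (X B)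
      rw [show u (X B) = v (X B) from hB]
  -- the three estimates for `v`
  have hp : Integrable (fun B => Real.exp (S B) * v (X B)) μ := (hup w hwp' v hvper hv0 hvint x n hκn hn2).1
  have hneg : ∀ B : Fin n → ℝ,
      Real.exp (w * ∑ k ∈ Finset.range n, -h (ahPhase w x (finExt B) k) * finExt B k) = Real.exp (-S B) := by
    intro B
    congr 1
    simp only [hSdef, neg_mul, Finset.sum_neg_distrib, mul_neg]
  obtain ⟨hm1, hm2⟩ := hum w hwm' v hvper hv0 hvint x n hκn hn2
  simp only [hneg] at hm1 hm2
  obtain ⟨-, hl⟩ := hlow w hwL' v hvm hvper hv0 hvint x n hn1 hn2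
  have hCS := sq_integral_le_tilt μ hSm (hvm.comp hXm) (fun B => hv0 _) hp hm1
  -- conclusion for `v`, then back to `u`
  set Iv : ℝ := ∫ y in Set.Ico (0:ℝ) 1, v y with hIv
  have hIv0 : 0 ≤ Iv := setIntegral_nonneg measurableSet_Ico fun y _ => hv0 y
  set P : ℝ := ∫ B, Real.exp (S B) * v (X B) ∂μ with hP
  have hP0 : 0 ≤ P := integral_nonneg fun B => mul_nonneg (Real.exp_pos _).le (hv0 _)
  have hM : ∫ B, Real.exp (-S B) * v (X B) ∂μ ≤ 2 * Km * Iv := by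
    refine hm2.trans ?_
    have : Km / (w * Real.sqrt n) ≤ 2 * Km := by
      rw [div_le_iff₀ (by positivity)]; nlinarith
    exact mul_le_mul_of_nonneg_right this hIv0
  have hE : KL * Iv ≤ ∫ B, v (X B) ∂μ := hl
  have hkey : K' * Iv ≤ P := by
    rcases hIv0.lt_or_eq with hIpos | hI0
    · have h1 : (KL * Iv) ^ 2 ≤ P * (2 * Km * Iv) := by
        calc (KL * Iv) ^ 2 ≤ (∫ B, v (X B) ∂μ) ^ 2 := pow_le_pow_left₀ (by positivity) hE 2
          _ ≤ P * ∫ B, Real.exp (-S B) * v (X B) ∂μ := hCS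
          _ ≤ P * (2 * Km * Iv) := mul_le_mul_of_nonneg_left hM hP0
      rw [hK', div_mul_eq_mul_div, div_le_iff₀ (by positivity)]
      nlinarith
    · rw [← hI0, mul_zero]; exact hP0
  calc K' * ∫ y in Set.Ico (0:ℝ) 1, u y = K' * Iv := by rw [hintv]
    _ ≤ P := hkey
    _ = ∫ B, Real.exp (S B) * u (X B) ∂μ := (integral_congr_ae haeΘ).symm

/-- **Theorem 1.1 of Ajanki–Huveneers 2011 DISCHARGED**: the vendored barrier fact
`AjankiHuveneers2011_scaling` — the `n^{-3/2}` law for the mass-averaged stationary current of the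
disordered harmonic chain between white-noise Langevin baths — holds. Assembly of the cluster:
steady state and current formula (`…SteadyState`, `…CurrentProofs`), transfer-matrix reduction
(`…Transfer`, `…Adjoint`), high frequencies via Fürstenberg positivity (`…Positivity`), the
low-frequency upper bound (U) (`AjankiHuveneers2011_lowFrequencyBound_holds`, `…PointwiseU`) and
the critical-band lower bound (L) from Prop. 5.1 (`…ResonantSet` with
`AjankiHuveneers2011_potentialTheory_holds`).
[cite: AjankiHuveneers2011, Thm 1.1 (with §2.1, §3-§6)] -/
theorem AjankiHuveneers2011_scaling_holds : AjankiHuveneers2011_scaling :=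
  AjankiHuveneers2011_scaling_of_lowFrequency AjankiHuveneers2011_lowFrequencyBound_holds
    (AjankiHuveneers2011_criticalBandLowerBound_of_potentialTheory AjankiHuveneers2011_potentialTheory_holds)

end Literature.Barriers.AtomisticToContinuum

end
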